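import Literature.AlgebraicGeometry.Frobenioids.BiratUnitsDiv
import Literature.AlgebraicGeometry.Frobenioids.PerfectionGroupificationEquiv
import HarnessLib

/-!
# [FrdI] Prop. 4.4 (ii)–(iii) / §0: unique divisibility of `O^×(A^birat)` from the unit sequence, and
# sections of the divisor map from monoid-level sections

Mochizuki, *The geometry of Frobenioids I: the general theory*, Kyushu J. Math. **62** (2008)
293–400, §0 p. 11 ("perfect": every `n`-th power map bijective; `M^gp`, `M^pf`) and §4 Prop. 4.4
(ii)–(iii) p. 83 (the exact unit sequence `1 → O^×(A) → O^×(A^birat) → Φ^birat(A) → 1`)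
[cite: MochizukiFrdI2008, Prop. 4.4 (iii) p.83].  Used by [FrdII] Thm. 3.6 (i) (kurims p. 36) for
`C^ℚ = C^pf`: there `O^×(X) ≅ Φ^∡(K)^pf` and `Φ^birat = (Φ^pf)^gp` are uniquely divisible, hence so is
`O^×(X^birat)` — WITHOUT first splitting the sequence — and a multiplicative section of the divisor map
given on the divisor MONOID `Φ(d)` (germs of positive real scalars) extends to the group
`(Φ(d)^pf)^gp` [cite: MochizukiFrdII2008, Thm 3.6 (i) p.36] (abc-iut cell, layer L1, row M13-c3 FILE
B-generic pieces (5)–(6) for L1-t6's FILE B-arch; seat abc-iut-w5-d194).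

* `injective_pow_of_exact`, `surjective_pow_of_exact`, `bijective_pow_of_exact` — for an exact
  `1 → U —i→ B —d→ G → 1` of groups with `B` commutative (`d` onto for surjectivity): injectivity /
  surjectivity / bijectivity of the `n`-th power maps of `U` and `G` pass to `B` (generic);
* `BiratUnits.bijective_pow_of_range`, `BiratUnits.bijective_pow_of_surjective` — the unit sequence
  instances (`i = unitsToBirat`, `d = divHom` restricted to `Φ^birat(A) = divHomRange`, resp. `divHom`
  onto `Φ^gp(A)`);
* `gpSection σ₀ = GrothendieckGroup.lift σ₀` with `apply_gpSection : δ (gpSection σ₀ x) = x` when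
  `δ ∘ σ₀ = ι_gp` — a monoid-level section of `δ : B → M^gp` extends to the group `M^gp`;
* `gpPerfSection hB σ₀ = GrothendieckGroup.lift (Perfection.extend hB σ₀)` with `apply_gpPerfSection` —
  for PERFECT `B`, a section on `M` of `δ : B → (M^pf)^gp` extends to `(M^pf)^gp`.
Classical algebra; no statement of the paper is strengthened; nothing here bears on [IUTchIII].
-/

noncomputable section

namespace Literature.AlgebraicGeometry.Frobenioids

open Function Literature.AnabelianGeometry.EtaleTheta

/-! ### Power maps in the middle of an exact sequence (generic) -/

section ExactPow

variable {U B G : Type*} [Group U] [Group B] [Group G] {i : U →* B} {d : B →* G}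

/-- In an exact `1 → U —i→ B —d→ G` with `B` commutative: if the `n`-th power maps of `U` and `G` are
injective, so is that of `B` (`xⁿ = yⁿ ⇒ d x = d y ⇒ x y⁻¹ = i u` with `(i u)ⁿ = 1 ⇒ u = 1`).
(folklore group theory behind FrdI Prop. 4.4 (iii)) [cite: MochizukiFrdI2008, Prop. 4.4 (iii) p.83] -/
theorem injective_pow_of_exact (hi : Injective i) (hrange : i.range = d.ker)
    (hcomm : ∀ x y : B, x * y = y * x) {n : ℕ} (hU : Injective fun u : U => u ^ n)
    (hG : Injective fun g : G => g ^ n) : Injective fun b : B => b ^ n := by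
  intro x y hxy
  have hxy' : x ^ n = y ^ n := hxy
  have h1 : d x = d y := by
    apply hG
    show d x ^ n = d y ^ n
    rw [← map_pow, ← map_pow, hxy']
  have hk : x * y⁻¹ ∈ d.ker := by
    rw [MonoidHom.mem_ker, map_mul, map_inv, h1, mul_inv_cancel]
  rw [← hrange] at hk
  obtain ⟨u, hu⟩ := hk
  have hun : u ^ n = 1 := by
    apply hi
    rw [map_pow, hu, map_one, Commute.mul_pow (hcomm x y⁻¹) n, inv_pow, hxy', mul_inv_cancel]
  have hu1 : u = 1 := hU (show u ^ n = 1 ^ n by rw [hun, one_pow])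
  rw [hu1, map_one] at hu
  exact mul_inv_eq_one.mp hu.symm

/-- In an exact `1 → U —i→ B —d→ G → 1` (`d` onto) with `B` commutative: if the `n`-th power maps of
`U` and `G` are surjective, so is that of `B` (`d b = g'ⁿ`, `g' = d c`, `b c⁻ⁿ = i u = i u'ⁿ`,
`b = (i u' · c)ⁿ`). (folklore group theory behind FrdI Prop. 4.4 (iii))
[cite: MochizukiFrdI2008, Prop. 4.4 (iii) p.83] -/
theorem surjective_pow_of_exact (hrange : i.range = d.ker) (hd : Surjective d)
    (hcomm : ∀ x y : B, x * y = y * x) {n : ℕ} (hU : Surjective fun u : U => u ^ n)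
    (hG : Surjective fun g : G => g ^ n) : Surjective fun b : B => b ^ n := by
  intro b
  obtain ⟨g', hg'⟩ := hG (d b)
  obtain ⟨c, hc⟩ := hd g'
  have hg'' : g' ^ n = d b := hg'
  have hk : b * (c ^ n)⁻¹ ∈ d.ker := by
    rw [MonoidHom.mem_ker, map_mul, map_inv, map_pow, hc, hg'', mul_inv_cancel]
  rw [← hrange] at hk
  obtain ⟨u, hu⟩ := hk
  obtain ⟨u', hu'⟩ := hU u
  have hu'' : u' ^ n = u := hu'
  refine ⟨i u' * c, ?_⟩
  show (i u' * c) ^ n = b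
  rw [Commute.mul_pow (hcomm (i u') c) n, ← map_pow, hu'', hu, inv_mul_cancel_right]

/-- **Perfectness of the middle term**: in an exact `1 → U —i→ B —d→ G → 1` (`i` injective, `d` onto,
`B` commutative) bijectivity of the `n`-th power maps of `U` and `G` gives bijectivity for `B`.
(folklore group theory behind FrdI Prop. 4.4 (iii)) [cite: MochizukiFrdI2008, Prop. 4.4 (iii) p.83] -/
theorem bijective_pow_of_exact (hi : Injective i) (hrange : i.range = d.ker) (hd : Surjective d)
    (hcomm : ∀ x y : B, x * y = y * x) {n : ℕ} (hU : Bijective fun u : U => u ^ n)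
    (hG : Bijective fun g : G => g ^ n) : Bijective fun b : B => b ^ n :=
  ⟨injective_pow_of_exact hi hrange hcomm hU.1 hG.1, surjective_pow_of_exact hrange hd hcomm hU.2 hG.2⟩

end ExactPow

/-! ### The unit sequence of `A^birat` -/

namespace PreFrobenioid

open CategoryTheory Opposite

namespace BiratUnits

universe w v v' u u'

variable {D : Type u} [Category.{v} D] {Φ : Dᵒᵖ ⥤ CommMonCat.{w}}
  {C : Type u'} [Category.{v'} C] {F : C ⥤ ElemFrobenioid Φ} {hF : IsFrobenioid F} {A : C}

/-- Exactness of the unit sequence with the divisor map restricted to its image `Φ^birat(A)`.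
[cite: MochizukiFrdI2008, Prop. 4.4 (iii) p.83] -/
theorem range_unitsToBirat_eq_ker_rangeRestrict :
    (unitsToBirat hF A).range = (divHom hF A).rangeRestrict.ker := by
  rw [MonoidHom.ker_rangeRestrict]
  exact ker_divHom_eq_range.symm

/-- **`O^×(A^birat)` has bijective `n`-th power map as soon as `O^×(A)` and `Φ^birat(A)` do** (for
`O^×(A^birat)` commutative, e.g. `A` birationally Frobenius-normalized) — no splitting of the unit
sequence is needed. [cite: MochizukiFrdI2008, Prop. 4.4 (iii) p.83] -/
theorem bijective_pow_of_range (hab : ∀ x y : BiratUnits F hF A, x * y = y * x) {n : ℕ}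
    (hU : Bijective fun u : unitsSubgroup F A => u ^ n)
    (hG : Bijective fun g : divHomRange hF A => g ^ n) :
    Bijective fun b : BiratUnits F hF A => b ^ n :=
  bijective_pow_of_exact unitsToBirat_injective range_unitsToBirat_eq_ker_rangeRestrict
    (divHom hF A).rangeRestrict_surjective hab hU hG

/-- The same when the divisor map is onto `Φ^gp(A)` (then `Φ^birat(A) = Φ^gp(A)`): bijectivity of the
`n`-th power maps of `O^×(A)` and `Φ^gp(A)` gives it for `O^×(A^birat)`.
[cite: MochizukiFrdI2008, Prop. 4.4 (iii) p.83] -/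
theorem bijective_pow_of_surjective (hab : ∀ x y : BiratUnits F hF A, x * y = y * x)
    (hsurj : Surjective (divHom hF A)) {n : ℕ} (hU : Bijective fun u : unitsSubgroup F A => u ^ n)
    (hG : Bijective fun g : PhiGp F A => g ^ n) : Bijective fun b : BiratUnits F hF A => b ^ n :=
  bijective_pow_of_exact unitsToBirat_injective ker_divHom_eq_range.symm hsurj hab hU hG

/-- Injectivity alone: injective power maps on `O^×(A)` and `Φ^gp(A)` give an injective power map on
`O^×(A^birat)` (commutative). [cite: MochizukiFrdI2008, Prop. 4.4 (iii) p.83] -/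
theorem injective_pow_of_units_of_phiGp (hab : ∀ x y : BiratUnits F hF A, x * y = y * x) {n : ℕ}
    (hU : Injective fun u : unitsSubgroup F A => u ^ n) (hG : Injective fun g : PhiGp F A => g ^ n) :
    Injective fun b : BiratUnits F hF A => b ^ n :=
  injective_pow_of_exact unitsToBirat_injective ker_divHom_eq_range.symm hab hU hG

end BiratUnits

end PreFrobenioid

/-! ### Sections of `δ : B → M^gp`, `B → (M^pf)^gp` from monoid-level sections (generic) -/

section Sections

universe w

variable {M : Type w} [CommMonoid M] {B : Type w} [CommGroup B]

/-- The group-level extension `M^gp → B` of a monoid homomorphism `σ₀ : M → B` (`GrothendieckGroup.lift`).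
[cite: MochizukiFrdI2008, §0 p.11] -/
def gpSection (σ₀ : M →* B) : Algebra.GrothendieckGroup M →* B :=
  Algebra.GrothendieckGroup.lift σ₀

/-- `gpSection σ₀` restricts to `σ₀` on `M`. [cite: MochizukiFrdI2008, §0 p.11] -/
@[simp] theorem gpSection_of (σ₀ : M →* B) (a : M) :
    gpSection σ₀ (Algebra.GrothendieckGroup.of a) = σ₀ a :=
  gp_lift_of σ₀ a

/-- **A monoid-level section of `δ : B → M^gp` extends to a section on `M^gp`**: if `δ (σ₀ a) = [a]`
for `a ∈ M` then `δ ∘ gpSection σ₀ = id`. [cite: MochizukiFrdI2008, §0 p.11] -/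
theorem comp_gpSection_eq_id (δ : B →* Algebra.GrothendieckGroup M) (σ₀ : M →* B)
    (h : ∀ a, δ (σ₀ a) = Algebra.GrothendieckGroup.of a) :
    δ.comp (gpSection σ₀) = MonoidHom.id _ := by
  apply gp_hom_ext
  ext a
  change δ (gpSection σ₀ (Algebra.GrothendieckGroup.of a)) = Algebra.GrothendieckGroup.of a
  rw [gpSection_of, h]

/-- Pointwise form of `comp_gpSection_eq_id`. [cite: MochizukiFrdI2008, §0 p.11] -/
theorem apply_gpSection (δ : B →* Algebra.GrothendieckGroup M) (σ₀ : M →* B)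
    (h : ∀ a, δ (σ₀ a) = Algebra.GrothendieckGroup.of a) (x : Algebra.GrothendieckGroup M) :
    δ (gpSection σ₀ x) = x :=
  DFunLike.congr_fun (comp_gpSection_eq_id δ σ₀ h) x

/-- For PERFECT `B`: the extension `(M^pf)^gp → B` of `σ₀ : M → B` — `GrothendieckGroup.lift` of the
extension `M^pf → B` to the perfection (`Perfection.extend`). [cite: MochizukiFrdI2008, §0 p.11] -/
def gpPerfSection (hB : IsPerfect B) (σ₀ : M →* B) : Algebra.GrothendieckGroup (Perfection M) →* B :=
  Algebra.GrothendieckGroup.lift (Perfection.extend hB σ₀)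

/-- `gpPerfSection` on `M^pf ⊆ (M^pf)^gp` is `Perfection.extend hB σ₀`. [cite: MochizukiFrdI2008, §0 p.11] -/
@[simp] theorem gpPerfSection_of (hB : IsPerfect B) (σ₀ : M →* B) (p : Perfection M) :
    gpPerfSection hB σ₀ (Algebra.GrothendieckGroup.of p) = Perfection.extend hB σ₀ p :=
  gp_lift_of _ p

/-- `gpPerfSection` restricts to `σ₀` on `M`. [cite: MochizukiFrdI2008, §0 p.11] -/
@[simp] theorem gpPerfSection_of_of (hB : IsPerfect B) (σ₀ : M →* B) (a : M) :
    gpPerfSection hB σ₀ (Algebra.GrothendieckGroup.of (Perfection.of M a)) = σ₀ a := by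
  rw [gpPerfSection_of, Perfection.extend_of]

/-- The value on a class `[a^{1/n}]` is THE `n`-th root of `σ₀ a` in the perfect group `B`:
`(gpPerfSection hB σ₀ [a^{1/n}])ⁿ = σ₀ a`. [cite: MochizukiFrdI2008, §0 p.11] -/
theorem gpPerfSection_of_mk_pow (hB : IsPerfect B) (σ₀ : M →* B) (a : M) (n : ℕ+) :
    gpPerfSection hB σ₀ (Algebra.GrothendieckGroup.of (Perfection.mk a n)) ^ (n : ℕ) = σ₀ a := by
  rw [← map_pow, ← map_pow, Perfection.mk_pow_self, gpPerfSection_of_of]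

/-- **A monoid-level section of `δ : B → (M^pf)^gp` extends to a section on `(M^pf)^gp`** (for perfect
`B`): if `δ (σ₀ a) = [a]` for `a ∈ M` then `δ ∘ gpPerfSection hB σ₀ = id` (group homomorphisms out
of `(M^pf)^gp` agreeing on `M^pf`; there, homomorphisms out of the perfection into the perfect group
`(M^pf)^gp` agreeing on `M`). [cite: MochizukiFrdI2008, §0 p.11] -/
theorem comp_gpPerfSection_eq_id (hB : IsPerfect B) (δ : B →* Algebra.GrothendieckGroup (Perfection M))
    (σ₀ : M →* B) (h : ∀ a, δ (σ₀ a) = Algebra.GrothendieckGroup.of (Perfection.of M a)) :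
    δ.comp (gpPerfSection hB σ₀) = MonoidHom.id _ := by
  apply gp_hom_ext
  rw [MonoidHom.id_comp, MonoidHom.comp_assoc]
  apply Perfection.hom_ext_of_isPerfect (isPerfect_gp_perfection M)
  ext a
  change δ (gpPerfSection hB σ₀ (Algebra.GrothendieckGroup.of (Perfection.of M a))) =
    Algebra.GrothendieckGroup.of (Perfection.of M a)
  rw [gpPerfSection_of_of, h]

/-- Pointwise form of `comp_gpPerfSection_eq_id`. [cite: MochizukiFrdI2008, §0 p.11] -/
theorem apply_gpPerfSection (hB : IsPerfect B) (δ : B →* Algebra.GrothendieckGroup (Perfection M))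
    (σ₀ : M →* B) (h : ∀ a, δ (σ₀ a) = Algebra.GrothendieckGroup.of (Perfection.of M a))
    (x : Algebra.GrothendieckGroup (Perfection M)) : δ (gpPerfSection hB σ₀ x) = x :=
  DFunLike.congr_fun (comp_gpPerfSection_eq_id hB δ σ₀ h) x

/-- A section commutes with everything in a commutative `B` (the `hcomm` input of `splitProd`).
[cite: MochizukiFrdI2008, §0 p.11] -/
theorem section_comm (σ : Algebra.GrothendieckGroup (Perfection M) →* B) (b : B)
    (x : Algebra.GrothendieckGroup (Perfection M)) : b * σ x = σ x * b :=
  mul_comm _ _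

end Sections

end Literature.AlgebraicGeometry.Frobenioids

end
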